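import Summits.QuantumFields.YangMills.Theorems.BalabanUVNodesN22EdgeAtW1Reading13
import Summits.QuantumFields.YangMills.Theorems.BalabanUVNodesRateReadingOfRecord13Co
import Summits.QuantumFields.YangMills.Theorems.BalabanUVNodesN22EdgeAtW1Reading12

/-!
# CORE EDITION of 7″ `BalabanUVNodesN22EdgeAtW1Reading13` (p495618) — THE EDGE N18 → N22 at any `hpin`-reading ∕ the reading of record: STRIP (regime home) + ANALYTIC (canonical ∕ regime) — KEYED ON THE bg-FREE PROVISO CORE `Stage13Params.Provisos₁₃Core` (the LAST re-key of this module).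
#
# WHY THIS FILE EXISTS (plan g67 ★ CORE-YES, pub-ymgap INBOX l.17420; WORD-139 (1) l.16747; dag-lead WORDS-139 (3) l.16541; RR-2 g11 CORE l.17476; this seat's
# DESIGN-INPUT-CORE l.17415).  The Stage-13 record's proviso structure is being re-pinned row by row toward print (v1.1 `Provisos₁₃` → v1.2 `Provisos₁₃Sep`
# (separated sequences + `PartCompat₁₃`, director-ym №136–№139) → v1.3 `Provisos₁₃SepMixed` (+ `Sect2.DataSmall7`, №142) → …); each edition re-mints the four cruxes and
# would re-key every storey typed `∀ θ (h : θ.Provisos₁₃<ed> F N), …`.  But the rate-side storeys are bg-BLIND and proviso-FIELD-blind: `h` enters only as a binder TYPE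
# and inside `datumOfRecord₁₃<ed> F N θ h`; def-T's `Node00/Record13` v1.2 (p501191) carries the edition-free proviso CORE `Stage13Params.Provisos₁₃Core` (the nine non-bg rows)
# with the maps `Provisos₁₃<ed>.toCore`, and — after director-ym №151∕№152 re-based the record at print's background U_k(V) (`UbgOfRecord₁₃Co`) — def-T's FILE 21
# `Node00/Record13Co` (p515035) carries the Core-KEYED tower ∕ datum ∕ record `towerOfRecord₁₃Co ∕ datumOfRecord₁₃Co ∕ IsRecordOfRecord₁₃CCo` with the `rfl` bridges
# `datumOfRecord₁₃<ed> F N θ h = datumOfRecord₁₃Co F N θ h.toCore` for every LATER edition (v1.4 `SepCo`, KEY-RULE-21 R4; v1.2's U_old `datumOfRecord₁₃Core` is superseded,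
# def-T HOLD-21C).  So plan ruled (CORE-YES):
# CONSUMER storeys key ONCE on `(hc : θ.Provisos₁₃Core F N)` ∕ `datumOfRecord₁₃Co` ∕ RR-2's bg-free datum key `Node00/Record13DatumKeyCo` (p515777; its `IsDatumOfRecord…` ∕ `IsRateKey…` classes,
# the record classes `IsRecordOfRecord…`, one-way bridges `.toCore` from every edition's keys), while the ITEM texts and the registered STUB texts stay
# edition-keyed and ONLY the K3 composer touches the item's proviso token — at an item tuple `(θ, h : θ.Provisos₁₃<ed> F 2)` it applies these storeys at `hc := h.toCore`,
# datum by `rfl`.  This file is the (T-RATE) pen's CORE twin of its own ‴ module under the token map `Provisos₁₃ ↦ Provisos₁₃Core` · `datumOfRecord₁₃ ↦ datumOfRecord₁₃Core` ·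
# `(Is|is)DatumOfRecord₁₃C… ↦ …₁₃CCore…` · `(Is|is)RecordOfRecord₁₃C… ↦ …₁₃CCore…` · `IsRateKey₁₃ ↦ IsRateKey₁₃Core` and, for THIS seat's names, `Core` inserted after `₁₃`
# in the stage-KEYED stems only (`RateReading₁₃`, `rateCarriersOfRecord₁₃`, `RRec₁₃(On)`, `rRec₁₃…`, `readingOfRecord₁₃`, `…datumKey₁₃…`, `n22_tupleReadingOfRecord(On)…`).
# EVERYTHING θ-LEVEL IS UNCHANGED AND NOT RE-DECLARED: `Stage13Params`, `u3OfRecord₁₃ θ u k` and its faces, the θ-form closers `n22At_u3OfRecord₁₃_…` of the ‴ modules carry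
# no proviso and are IMPORTED BY NAME (this module imports its ‴ original) — here: `n22At_u3OfRecord₁₃_w1_of_n18Below_analytic`.  Statements = the ‴ statements under the map, proofs = the ‴ proofs verbatim.  The ⁗
# `…13Sep…` twin of this module (rev-18∕19 homes) stays in the tree as the ⁗ asides' context.  NOMINAL STRENGTH: Core-keyed storeys quantify over more tuples (no bg row) —
# harmless: every hypothesis here is θ-generic under `θ.Admissible` and the slot data, none reads `bg`.
#
# ITEM IDS: crux names ∕ item ids quoted in the ‴ header below (K0‴–K3‴ = stmt-QuantumFields-19909…19912) are the rev-16∕17 ones, ASIDES now; this file is filed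
# `--supports stmt-QuantumFields-20292` (the K3 item of record at filing time, per dag-lead's KEY MAP) as a HELPER — count-neutral, no stub closed, N22 NOT discharged, no inhabitant of
# any key claimed (K0 OPEN at every edition).
#
# ‴ HEADER OF RECORD FOLLOWS (token-mapped; its decl lists are this file's, the θ-only names above excepted):
#
# BalabanUVNodes ∕ node N22 ⟸ node N18 AT A W1-PINNED READING OF THE STAGE-13 HOMES `RRec₁₃Co 𝔯` ∕ `RRec₁₃CoOn 𝔯 Rg` and AT THE STAGE-13 READING OF RECORD — the edge
# N18 → N22 BY NAME at `Record13`, in the STRIP currency (dag-n22-c's θ-form `n22At_u3OfRecord₁₂_w1Reading_of_n18Below_stripBound`) and in the ANALYTIC sup-letter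
# currency (A) (the lineage's θ-form `n22At_u3OfRecord₁₂_w1_of_n18Below_analytic`), both read at Stage 13 through layer B's `rfl` bridge `u3OfRecord₁₃_eq_u3OfRecord₁₂`

Track A of `YM-PLAN.md` (cell `pub-ymgap`, HUMAN RULING D-0062), R134 seat `pub-ymgap-dag-n22-e` (s2 «`FadingMemory` by name from a modulus + knit at the record»), gen 5,
module 7″ = the Stage-13 edition of the lineage's module 7 `…N22EdgeAtW1Reading12.lean` (p478043), GENERALISED (like 9″c) from the one named reading
`ofAssignment (W1.assignment₁₂ 𝔇) ne1` to EVERY Stage-13 reading with the W1 pin `hpin : ∀ F θ hP g₀ os, (𝔯.lit F θ hP g₀ os).u3 = (w1 F θ).u3Objects θ.γ`, and instantiated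
at the reading of record `readingOfRecord₁₃Co w1 ℓ₃ ne2 ne1` (module 6″, `hpin := rfl`).  Director-ym LINE №125 «RECORD 13» ∕ №133 ∕ №135 (route rev 17 READY, K3‴
`SpineGivenEndpointR13` = stmt-QuantumFields-19912); dag-lead WORDS-133 ∕ 134 ∕ 135.  THEOREMS ONLY; every proof is one application BY NAME of the Stage-12 θ-forms (dag-n22-c
`…N22W1StripN18Edge` p476424 §1–§2; this lineage's module 7 §2) at the parent tuple `θ.toStage12Params` — the Stage-13 bundle IS the Stage-12 bundle of the parent tuple
(`u3OfRecord₁₃_eq_u3OfRecord₁₂`, `rfl`) — composed with the Stage-13 homes' θ-forms (`s_N18 ∕ s_N22_rRec₁₃Co(On)_iff`, 9″c's `s_N22_rRec₁₃Co_w1_iff`).  Restate-immune (no Theses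
import); COUNT-NEUTRAL; `--supports` K3‴ as a helper.

WHAT IS KERNEL-CHECKED ([folklore]; 0 `def`, 0 `sorry`).
* §1 `s_N22_rRec₁₃CoOn_w1_of_s_N18_stripBound` — REGIME ∕ TUPLE HOME × STRIP: `S_N18 (RRec₁₃CoOn 𝔯 Rg)` + per admissible tuple in `Rg` dag-n22-c's coherence ∕ junk binder `hcoh`
  for `w1 F θ`, the inputs' numerals and STRIP-(1.18) per run length ⟹ `S_N22 (RRec₁₃CoOn 𝔯 Rg)`.
* §2 `n22At_u3OfRecord₁₃_w1_of_n18Below_analytic` — θ-form at ONE Stage-13 tuple, analytic currency: N18 below `k` + (C1)(C2)(J) + (A) at `k` + numerals ⟹ `N22At` at `k`.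
* §3 `s_N22_rRec₁₃Co_w1_of_s_N18_analytic` (canonical home × (A)) · `s_N22_rRec₁₃CoOn_w1_of_s_N18_analytic` (regime home × (A)).
* §4 AT THE READING OF RECORD (6″): `s_N22_readingOfRecord₁₃Co_of_s_N18_analytic` · `s_N22_readingOfRecord₁₃CoOn_of_s_N18_analytic` · `s_N22_readingOfRecord₁₃CoOn_of_s_N18_stripBound`.

HONEST FRAMING.  The edge TRANSFERS node N18's stub (a hypothesis at the same reading; dag-n18-d's lane) and dag-n22-c's displayed regularity inputs (STRIP-(1.18) per run length,
or the analytic sup letter (A); coherence (C1)(C2), junk-freeness (J); numerals) into node N22's stub; none of these has a producer at a reading of record today; W1's towers are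
residual DATA; nothing of Bałaban's is asserted or instantiated — NE5 ∕ NE9 NOT PRINTED for d = 4 and NOT PROVED; no inhabitant of `IsDatumOfRecord₁₃CCo` claimed (K0‴
`Record13Inhabited`, stmt-QuantumFields-19909, OPEN); N22 NOT discharged; counts UNMOVED (typed 28∕28 · discharged 5∕27, A 5∕28); one finite four-torus programme at fixed `ε` —
NOT ℝ⁴, NOT infinite volume, NOT OS, NOT a mass gap, NOT Clay.  No decl below carries a cite tag.
-/

noncomputable section

namespace YMDAG.N22

open Set Metric
open scoped BigOperators
open Literature.MathematicalPhysics.QuantumFieldTheory.Balaban1983to89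
open Literature.MathematicalPhysics.QuantumFieldTheory.Balaban1983to89.T4Continuum
open Literature.MathematicalPhysics.QuantumFieldTheory.Balaban1983to89.T4OutputRate
open Literature.MathematicalPhysics.QuantumFieldTheory.Balaban1983to89.TreeLengthTorus (torusTreeLen)
open Literature.MathematicalPhysics.QuantumFieldTheory.Balaban1983to89.Node00 (Stage13Params IsDatumOfRecord₁₃CCo NE2Objects₁₁ NE3Letters₁₁ MatA)
open Literature.MathematicalPhysics.QuantumFieldTheory.Balaban1983to89.Node00.Sect2 (domSys CPair)
open Literature.MathematicalPhysics.QuantumFieldTheory.Balaban1983to89.Node00.W1 (ReadingData termC)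
open YMDAG.UVSplit
open YMDAG.N22.W1 (oscFading_w1Reading_of_n18At_below n22At_u3OfRecord₁₂_w1Reading_of_n18Below_stripBound)

variable {N : ℕ} [NeZero N]

/-! ## §1 The edge at the regime ∕ tuple home `RRec₁₃CoOn 𝔯 Rg`, strip currency, for a W1-pinned reading -/

section RegimeStrip

variable (𝔯 : RateReading₁₃Co N) (w1 : (F : T4Family) → (θ : Stage13Params F N) → ReadingData F (MatA N) θ.τ9.M) (Rg : (F : T4Family) → Stage13Params F N → Prop)

open Classical in
/-- **THE EDGE N18 → N22 AT A W1-PINNED STAGE-13 READING, REGIME ∕ TUPLE HOME, STRIP CURRENCY.**  For ANY reading `𝔯` with `(𝔯.lit F θ hP g₀ os).u3 = (w1 F θ).u3Objects θ.γ`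
and ANY regime `Rg`: `S_N18 (RRec₁₃CoOn 𝔯 Rg)` together with, per admissible Stage-13 tuple with provisos IN `Rg`, dag-n22-c's coherence ∕ junk binder `hcoh` for `w1 F θ`, the
inputs' numerals and STRIP-(1.18) per run length (their `hstrip` verbatim) ⟹ `S_N22 (RRec₁₃CoOn 𝔯 Rg)` — their θ-form at the parent tuple `θ.toStage12Params`, read through 5″'s
guarded θ-forms.  Every hypothesis is asked ONLY in the regime. [folklore] -/
theorem s_N22_rRec₁₃CoOn_w1_of_s_N18_stripBound
    (hpin : ∀ (F : T4Family) (θ : Stage13Params F N) (hP : θ.Provisos₁₃Core F N) (g₀ : ℕ → ℝ) (os : List (ULoop F)), (𝔯.lit F θ hP g₀ os).u3 = (w1 F θ).u3Objects θ.γ)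
    (h18 : S_N18 (RRec₁₃CoOn 𝔯 Rg))
    (hcoh : ∀ (F : T4Family) (θ : Stage13Params F N), θ.Provisos₁₃Core F N → Rg F θ → θ.Admissible F N →
      (∀ (k : ℕ) (X₁ : Node00.W1.Dom (F.P k) θ.τ9.M), (((w1 F θ).pairing k).pair X₁).1 = X₁.1 + 1) ∧
      (∀ (k : ℕ) (X₁ : Node00.W1.Dom (F.P k) θ.τ9.M),
        (domSys (F.P (k + 1)) θ.τ9.M (((w1 F θ).pairing k).pair X₁).1).dj (((w1 F θ).pairing k).pair X₁).2 = (domSys (F.P k) θ.τ9.M X₁.1).dj X₁.2) ∧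
      (∀ (k : ℕ) (X : Node00.W1.Dom (F.P (k + 1)) θ.τ9.M), 1 ≤ X.1 → ∃ X₁ : Node00.W1.Dom (F.P k) θ.τ9.M, ((w1 F θ).pairing k).pair X₁ = X) ∧
      (∀ (k : ℕ) (U : ((w1 F θ).pairing (k + 1)).BgA), ∃ U₁ : ((w1 F θ).pairing k).BgB, ((w1 F θ).pairing k).embB U₁ = ((w1 F θ).pairing (k + 1)).embA U) ∧
      (∀ (k : ℕ) (g : ℕ → ℝ) (U : ((w1 F θ).pairing k).BgA) (X : Node00.W1.Dom (F.P k) θ.τ9.M), k < X.1 → ((w1 F θ).pairing k).EA ((w1 F θ).S k) g U X = 0))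
    (hnum : ∀ (F : T4Family) (θ : Stage13Params F N), θ.Provisos₁₃Core F N → Rg F θ → θ.Admissible F N →
      0 < (w1 F θ).li.C₀ ∧ 0 < (w1 F θ).li.θ₅ ∧ (w1 F θ).li.θ₅ < 1 ∧ 0 ≤ (w1 F θ).li.C₅ ∧
        2 * (w1 F θ).li.C₅ / (1 - (w1 F θ).li.θ₅) ≤ (w1 F θ).li.C₀ ∧ 0 < (w1 F θ).li.A ∧ (w1 F θ).li.θ₅ ≤ (w1 F θ).li.μ ∧
        (w1 F θ).li.C₀ ≤ 2 * (w1 F θ).li.A ∧ 0 < (w1 F θ).li.r ∧ 0 < (w1 F θ).li.s ∧ (w1 F θ).li.s < 1 ∧ 1 ≤ (w1 F θ).li.μ)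
    (hstrip : ∀ (F : T4Family) (θ : Stage13Params F N), θ.Provisos₁₃Core F N → Rg F θ → θ.Admissible F N → ∀ (k : ℕ),
      ∃ sp : (j : ℕ) → (domSys (F.P k) θ.τ9.M j).Dom → Set (CPair (F.P k) (MatA N)),
        (∀ (j : ℕ) (U : ((w1 F θ).pairing k).BgA) (Y : (domSys (F.P k) θ.τ9.M j).Dom), ((w1 F θ).pairing k).embA U ∈ sp j Y) ∧
        (∀ (j : ℕ) (g : ℕ → ℝ), g ∈ Window θ.γ → ∀ (i : ℕ) (Y : (domSys (F.P k) θ.τ9.M j).Dom) (ψ : CPair (F.P k) (MatA N)), ψ ∈ sp j Y →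
          ∃ (Ec : ℂ → ℂ) (O : Set ℂ), IsOpen O ∧ (∀ t ∈ Ioc (0 : ℝ) θ.γ, closedBall (t : ℂ) (w1 F θ).li.r ⊆ O) ∧ DifferentiableOn ℂ Ec O ∧
            (∀ z ∈ O, ‖Ec z‖ ≤ (w1 F θ).li.A * Real.exp (-((w1 F θ).li.κ * torusTreeLen Y.1))) ∧
            (∀ t ∈ Ioc (0 : ℝ) θ.γ, Ec t = termC ((w1 F θ).S k) j Y (Function.update g i t) ψ))) :
    S_N22 (RRec₁₃CoOn 𝔯 Rg) := by
  rw [s_N22_rRec₁₃CoOn_iff]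
  rw [s_N18_rRec₁₃CoOn_iff] at h18
  intro F θ hP hRg hθ g₀ os k
  obtain ⟨hfst, hdj, hsurj, hbg, hjunk⟩ := hcoh F θ hP hRg hθ
  obtain ⟨hC₀, hθ5, hθ1, hC5, hC₀', hA, hθμ, hCM, hr, hs0, hs1, hμ1⟩ := hnum F θ hP hRg hθ
  obtain ⟨sp, hsp, hall⟩ := hstrip F θ hP hRg hθ k
  have h18' : ∀ k' : ℕ, k' < k → N18At (u3OfRecord₁₂ θ.toStage12Params ((w1 F θ).u3Objects θ.γ) k') := fun k' _ => by
    rw [← u3OfRecord₁₃_eq_u3OfRecord₁₂, ← hpin F θ hP g₀ os]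
    exact h18 F θ hP hRg hθ g₀ os k'
  rw [hpin F θ hP g₀ os, u3OfRecord₁₃_eq_u3OfRecord₁₂]
  exact n22At_u3OfRecord₁₂_w1Reading_of_n18Below_stripBound θ.toStage12Params (w1 F θ) k sp hsp hall hfst hdj hsurj hbg hjunk h18' hC5 hθ1 hC₀' hC₀ hθ5 hA hμ1
    hθμ hCM hr hθ.toStage9.gamma_pos hs0 hs1

end RegimeStrip

/-! ## §3 The edge at the Stage-13 homes, analytic currency, for a W1-pinned reading -/

section StubAnalytic

variable (𝔯 : RateReading₁₃Co N) (w1 : (F : T4Family) → (θ : Stage13Params F N) → ReadingData F (MatA N) θ.τ9.M)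

/-- **THE EDGE N18 → N22 AT A W1-PINNED STAGE-13 READING, CANONICAL HOME, ANALYTIC CURRENCY.**  `S_N18 (RRec₁₃Co 𝔯)` and — per admissible Stage-13 tuple with provisos —
dag-n22-c's `hcoh` for `w1 F θ`, the analytic letter (A) at every run length (9″c's `hA` verbatim) and the numerals ⟹ `S_N22 (RRec₁₃Co 𝔯)`: at each datum key all run lengths are
bundles of record at the canonical parameter (layer B's `s_N18_rRec₁₃Co_iff` ∕ 9″c's `s_N22_rRec₁₃Co_w1_iff`), so §2 applies level by level.  This is 9″c's
`s_N22_rRec₁₃Co_w1_of_oscAnalytic` with its (O) hypothesis REPLACED by `S_N18` + `hcoh`. [folklore] -/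
theorem s_N22_rRec₁₃Co_w1_of_s_N18_analytic
    (hpin : ∀ (F : T4Family) (θ : Stage13Params F N) (hP : θ.Provisos₁₃Core F N) (g₀ : ℕ → ℝ) (os : List (ULoop F)), (𝔯.lit F θ hP g₀ os).u3 = (w1 F θ).u3Objects θ.γ)
    (h18 : S_N18 (RRec₁₃Co 𝔯))
    (hcoh : ∀ (F : T4Family) (θ : Stage13Params F N), θ.Provisos₁₃Core F N → θ.Admissible F N →
      (∀ (k : ℕ) (X₁ : Node00.W1.Dom (F.P k) θ.τ9.M), (((w1 F θ).pairing k).pair X₁).1 = X₁.1 + 1) ∧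
      (∀ (k : ℕ) (X₁ : Node00.W1.Dom (F.P k) θ.τ9.M),
        (domSys (F.P (k + 1)) θ.τ9.M (((w1 F θ).pairing k).pair X₁).1).dj (((w1 F θ).pairing k).pair X₁).2 = (domSys (F.P k) θ.τ9.M X₁.1).dj X₁.2) ∧
      (∀ (k : ℕ) (X : Node00.W1.Dom (F.P (k + 1)) θ.τ9.M), 1 ≤ X.1 → ∃ X₁ : Node00.W1.Dom (F.P k) θ.τ9.M, ((w1 F θ).pairing k).pair X₁ = X) ∧
      (∀ (k : ℕ) (U : ((w1 F θ).pairing (k + 1)).BgA), ∃ U₁ : ((w1 F θ).pairing k).BgB, ((w1 F θ).pairing k).embB U₁ = ((w1 F θ).pairing (k + 1)).embA U) ∧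
      (∀ (k : ℕ) (g : ℕ → ℝ) (U : ((w1 F θ).pairing k).BgA) (X : Node00.W1.Dom (F.P k) θ.τ9.M), k < X.1 → ((w1 F θ).pairing k).EA ((w1 F θ).S k) g U X = 0))
    (hA : ∀ (F : T4Family) (θ : Stage13Params F N), θ.Provisos₁₃Core F N → θ.Admissible F N → ∀ (k : ℕ),
      ∀ g ∈ Window θ.γ, ∀ (U : (((w1 F θ).u3Objects θ.γ).levelCarriers k).BgA) (X : (((w1 F θ).u3Objects θ.γ).levelCarriers k).Dom) (i : ℕ),
        i < (((w1 F θ).u3Objects θ.γ).levelCarriers k).scale X → ∃ (Fz : ℂ → ℂ) (Dset : Set ℂ), DifferentiableOn ℂ Fz Dset ∧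
          (∀ z ∈ Dset, ‖Fz z‖ ≤ (w1 F θ).li.A * (w1 F θ).li.μ ^ ((((w1 F θ).u3Objects θ.γ).levelCarriers k).scale X - 1 - i) *
            Real.exp (-(((w1 F θ).u3Objects θ.γ).κ * (((w1 F θ).u3Objects θ.γ).levelCarriers k).d X))) ∧
          (∀ t ∈ Ioc (0 : ℝ) θ.γ, closedBall (t : ℂ) (w1 F θ).li.r ⊆ Dset) ∧
          (∀ t ∈ Ioc (0 : ℝ) θ.γ, Fz t = (((w1 F θ).u3Objects θ.γ).EA k (Function.update g i t) U X : ℂ)))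
    (hnum : ∀ (F : T4Family) (θ : Stage13Params F N), θ.Provisos₁₃Core F N → θ.Admissible F N →
      0 < (w1 F θ).li.C₀ ∧ 0 < (w1 F θ).li.θ₅ ∧ (w1 F θ).li.θ₅ < 1 ∧ 0 ≤ (w1 F θ).li.C₅ ∧
        2 * (w1 F θ).li.C₅ / (1 - (w1 F θ).li.θ₅) ≤ (w1 F θ).li.C₀ ∧ 0 < (w1 F θ).li.A ∧ (w1 F θ).li.θ₅ ≤ (w1 F θ).li.μ ∧
        (w1 F θ).li.C₀ ≤ 2 * (w1 F θ).li.A ∧ 0 < (w1 F θ).li.r ∧ 0 < (w1 F θ).li.s ∧ (w1 F θ).li.s < 1) :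
    S_N22 (RRec₁₃Co 𝔯) := by
  rw [s_N22_rRec₁₃Co_w1_iff 𝔯 w1 hpin]
  rw [s_N18_rRec₁₃Co_iff] at h18
  intro F D h k
  obtain ⟨hfst, hdj, hsurj, hbg, hjunk⟩ := hcoh F h.params h.provisos h.admissible
  refine n22At_u3OfRecord₁₃_w1_of_n18Below_analytic h.params (w1 F h.params) k (fun k' _ => ?_) hfst hdj hsurj hbg hjunk
    (hA F h.params h.provisos h.admissible k) (hnum F h.params h.provisos h.admissible) h.gamma_pos
  rw [← hpin F h.params h.provisos (fun _ => 0) []]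
  exact h18 F D h (fun _ => 0) [] k'

/-- **THE SAME AT THE REGIME ∕ TUPLE HOME** `RRec₁₃CoOn 𝔯 Rg` (any regime `Rg`; 5″'s guarded θ-forms; the hypotheses asked only of the admissible tuples with provisos in the
regime). [folklore] -/
theorem s_N22_rRec₁₃CoOn_w1_of_s_N18_analytic (Rg : (F : T4Family) → Stage13Params F N → Prop)
    (hpin : ∀ (F : T4Family) (θ : Stage13Params F N) (hP : θ.Provisos₁₃Core F N) (g₀ : ℕ → ℝ) (os : List (ULoop F)), (𝔯.lit F θ hP g₀ os).u3 = (w1 F θ).u3Objects θ.γ)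
    (h18 : S_N18 (RRec₁₃CoOn 𝔯 Rg))
    (hcoh : ∀ (F : T4Family) (θ : Stage13Params F N), θ.Provisos₁₃Core F N → Rg F θ → θ.Admissible F N →
      (∀ (k : ℕ) (X₁ : Node00.W1.Dom (F.P k) θ.τ9.M), (((w1 F θ).pairing k).pair X₁).1 = X₁.1 + 1) ∧
      (∀ (k : ℕ) (X₁ : Node00.W1.Dom (F.P k) θ.τ9.M),
        (domSys (F.P (k + 1)) θ.τ9.M (((w1 F θ).pairing k).pair X₁).1).dj (((w1 F θ).pairing k).pair X₁).2 = (domSys (F.P k) θ.τ9.M X₁.1).dj X₁.2) ∧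
      (∀ (k : ℕ) (X : Node00.W1.Dom (F.P (k + 1)) θ.τ9.M), 1 ≤ X.1 → ∃ X₁ : Node00.W1.Dom (F.P k) θ.τ9.M, ((w1 F θ).pairing k).pair X₁ = X) ∧
      (∀ (k : ℕ) (U : ((w1 F θ).pairing (k + 1)).BgA), ∃ U₁ : ((w1 F θ).pairing k).BgB, ((w1 F θ).pairing k).embB U₁ = ((w1 F θ).pairing (k + 1)).embA U) ∧
      (∀ (k : ℕ) (g : ℕ → ℝ) (U : ((w1 F θ).pairing k).BgA) (X : Node00.W1.Dom (F.P k) θ.τ9.M), k < X.1 → ((w1 F θ).pairing k).EA ((w1 F θ).S k) g U X = 0))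
    (hA : ∀ (F : T4Family) (θ : Stage13Params F N), θ.Provisos₁₃Core F N → Rg F θ → θ.Admissible F N → ∀ (k : ℕ),
      ∀ g ∈ Window θ.γ, ∀ (U : (((w1 F θ).u3Objects θ.γ).levelCarriers k).BgA) (X : (((w1 F θ).u3Objects θ.γ).levelCarriers k).Dom) (i : ℕ),
        i < (((w1 F θ).u3Objects θ.γ).levelCarriers k).scale X → ∃ (Fz : ℂ → ℂ) (Dset : Set ℂ), DifferentiableOn ℂ Fz Dset ∧
          (∀ z ∈ Dset, ‖Fz z‖ ≤ (w1 F θ).li.A * (w1 F θ).li.μ ^ ((((w1 F θ).u3Objects θ.γ).levelCarriers k).scale X - 1 - i) *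
            Real.exp (-(((w1 F θ).u3Objects θ.γ).κ * (((w1 F θ).u3Objects θ.γ).levelCarriers k).d X))) ∧
          (∀ t ∈ Ioc (0 : ℝ) θ.γ, closedBall (t : ℂ) (w1 F θ).li.r ⊆ Dset) ∧
          (∀ t ∈ Ioc (0 : ℝ) θ.γ, Fz t = (((w1 F θ).u3Objects θ.γ).EA k (Function.update g i t) U X : ℂ)))
    (hnum : ∀ (F : T4Family) (θ : Stage13Params F N), θ.Provisos₁₃Core F N → Rg F θ → θ.Admissible F N →
      0 < (w1 F θ).li.C₀ ∧ 0 < (w1 F θ).li.θ₅ ∧ (w1 F θ).li.θ₅ < 1 ∧ 0 ≤ (w1 F θ).li.C₅ ∧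
        2 * (w1 F θ).li.C₅ / (1 - (w1 F θ).li.θ₅) ≤ (w1 F θ).li.C₀ ∧ 0 < (w1 F θ).li.A ∧ (w1 F θ).li.θ₅ ≤ (w1 F θ).li.μ ∧
        (w1 F θ).li.C₀ ≤ 2 * (w1 F θ).li.A ∧ 0 < (w1 F θ).li.r ∧ 0 < (w1 F θ).li.s ∧ (w1 F θ).li.s < 1) :
    S_N22 (RRec₁₃CoOn 𝔯 Rg) := by
  rw [s_N22_rRec₁₃CoOn_iff]
  rw [s_N18_rRec₁₃CoOn_iff] at h18
  intro F θ hP hRg hθ g₀ os k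
  obtain ⟨hfst, hdj, hsurj, hbg, hjunk⟩ := hcoh F θ hP hRg hθ
  rw [hpin F θ hP g₀ os]
  refine n22At_u3OfRecord₁₃_w1_of_n18Below_analytic θ (w1 F θ) k (fun k' _ => ?_) hfst hdj hsurj hbg hjunk (hA F θ hP hRg hθ k) (hnum F θ hP hRg hθ)
    hθ.toStage9.gamma_pos
  rw [← hpin F θ hP g₀ os]
  exact h18 F θ hP hRg hθ g₀ os k'

end StubAnalytic

/-! ## §4 The edge at the Stage-13 reading of record (module 6″), both homes, both currencies -/

section ReadingOfRecord

variable (w1 : (F : T4Family) → (θ : Stage13Params F N) → ReadingData F (MatA N) θ.τ9.M) (ℓ₃ : T4Family → NE3Letters₁₁)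
  (ne2 : (F : T4Family) → Stage13Params F N → (ℕ → ℝ) → List (ULoop F) → ℕ → NE2Objects₁₁)
  (ne1 : (F : T4Family) → Stage13Params F N → (ℕ → ℝ) → List (ULoop F) → NE1pCarriers)

/-- **THE EDGE AT THE READING OF RECORD, CANONICAL HOME, ANALYTIC CURRENCY** (§3 at `readingOfRecord₁₃Co w1 ℓ₃ ne2 ne1`, `hpin := rfl`; `ℓ₃ ∕ ne2 ∕ ne1` idle). [folklore] -/
theorem s_N22_readingOfRecord₁₃Co_of_s_N18_analytic
    (h18 : S_N18 (RRec₁₃Co (readingOfRecord₁₃Co w1 ℓ₃ ne2 ne1)))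
    (hcoh : ∀ (F : T4Family) (θ : Stage13Params F N), θ.Provisos₁₃Core F N → θ.Admissible F N →
      (∀ (k : ℕ) (X₁ : Node00.W1.Dom (F.P k) θ.τ9.M), (((w1 F θ).pairing k).pair X₁).1 = X₁.1 + 1) ∧
      (∀ (k : ℕ) (X₁ : Node00.W1.Dom (F.P k) θ.τ9.M),
        (domSys (F.P (k + 1)) θ.τ9.M (((w1 F θ).pairing k).pair X₁).1).dj (((w1 F θ).pairing k).pair X₁).2 = (domSys (F.P k) θ.τ9.M X₁.1).dj X₁.2) ∧
      (∀ (k : ℕ) (X : Node00.W1.Dom (F.P (k + 1)) θ.τ9.M), 1 ≤ X.1 → ∃ X₁ : Node00.W1.Dom (F.P k) θ.τ9.M, ((w1 F θ).pairing k).pair X₁ = X) ∧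
      (∀ (k : ℕ) (U : ((w1 F θ).pairing (k + 1)).BgA), ∃ U₁ : ((w1 F θ).pairing k).BgB, ((w1 F θ).pairing k).embB U₁ = ((w1 F θ).pairing (k + 1)).embA U) ∧
      (∀ (k : ℕ) (g : ℕ → ℝ) (U : ((w1 F θ).pairing k).BgA) (X : Node00.W1.Dom (F.P k) θ.τ9.M), k < X.1 → ((w1 F θ).pairing k).EA ((w1 F θ).S k) g U X = 0))
    (hA : ∀ (F : T4Family) (θ : Stage13Params F N), θ.Provisos₁₃Core F N → θ.Admissible F N → ∀ (k : ℕ),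
      ∀ g ∈ Window θ.γ, ∀ (U : (((w1 F θ).u3Objects θ.γ).levelCarriers k).BgA) (X : (((w1 F θ).u3Objects θ.γ).levelCarriers k).Dom) (i : ℕ),
        i < (((w1 F θ).u3Objects θ.γ).levelCarriers k).scale X → ∃ (Fz : ℂ → ℂ) (Dset : Set ℂ), DifferentiableOn ℂ Fz Dset ∧
          (∀ z ∈ Dset, ‖Fz z‖ ≤ (w1 F θ).li.A * (w1 F θ).li.μ ^ ((((w1 F θ).u3Objects θ.γ).levelCarriers k).scale X - 1 - i) *
            Real.exp (-(((w1 F θ).u3Objects θ.γ).κ * (((w1 F θ).u3Objects θ.γ).levelCarriers k).d X))) ∧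
          (∀ t ∈ Ioc (0 : ℝ) θ.γ, closedBall (t : ℂ) (w1 F θ).li.r ⊆ Dset) ∧
          (∀ t ∈ Ioc (0 : ℝ) θ.γ, Fz t = (((w1 F θ).u3Objects θ.γ).EA k (Function.update g i t) U X : ℂ)))
    (hnum : ∀ (F : T4Family) (θ : Stage13Params F N), θ.Provisos₁₃Core F N → θ.Admissible F N →
      0 < (w1 F θ).li.C₀ ∧ 0 < (w1 F θ).li.θ₅ ∧ (w1 F θ).li.θ₅ < 1 ∧ 0 ≤ (w1 F θ).li.C₅ ∧
        2 * (w1 F θ).li.C₅ / (1 - (w1 F θ).li.θ₅) ≤ (w1 F θ).li.C₀ ∧ 0 < (w1 F θ).li.A ∧ (w1 F θ).li.θ₅ ≤ (w1 F θ).li.μ ∧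
        (w1 F θ).li.C₀ ≤ 2 * (w1 F θ).li.A ∧ 0 < (w1 F θ).li.r ∧ 0 < (w1 F θ).li.s ∧ (w1 F θ).li.s < 1) :
    S_N22 (RRec₁₃Co (readingOfRecord₁₃Co w1 ℓ₃ ne2 ne1)) :=
  s_N22_rRec₁₃Co_w1_of_s_N18_analytic _ w1 (fun _ _ _ _ _ => rfl) h18 hcoh hA hnum

/-- **THE EDGE AT THE READING OF RECORD, REGIME HOME, ANALYTIC CURRENCY** (any regime `Rg`; `Node00.unityNondeg₁₃ N` is rev 16's binder prefix). [folklore] -/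
theorem s_N22_readingOfRecord₁₃CoOn_of_s_N18_analytic (Rg : (F : T4Family) → Stage13Params F N → Prop)
    (h18 : S_N18 (RRec₁₃CoOn (readingOfRecord₁₃Co w1 ℓ₃ ne2 ne1) Rg))
    (hcoh : ∀ (F : T4Family) (θ : Stage13Params F N), θ.Provisos₁₃Core F N → Rg F θ → θ.Admissible F N →
      (∀ (k : ℕ) (X₁ : Node00.W1.Dom (F.P k) θ.τ9.M), (((w1 F θ).pairing k).pair X₁).1 = X₁.1 + 1) ∧
      (∀ (k : ℕ) (X₁ : Node00.W1.Dom (F.P k) θ.τ9.M),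
        (domSys (F.P (k + 1)) θ.τ9.M (((w1 F θ).pairing k).pair X₁).1).dj (((w1 F θ).pairing k).pair X₁).2 = (domSys (F.P k) θ.τ9.M X₁.1).dj X₁.2) ∧
      (∀ (k : ℕ) (X : Node00.W1.Dom (F.P (k + 1)) θ.τ9.M), 1 ≤ X.1 → ∃ X₁ : Node00.W1.Dom (F.P k) θ.τ9.M, ((w1 F θ).pairing k).pair X₁ = X) ∧
      (∀ (k : ℕ) (U : ((w1 F θ).pairing (k + 1)).BgA), ∃ U₁ : ((w1 F θ).pairing k).BgB, ((w1 F θ).pairing k).embB U₁ = ((w1 F θ).pairing (k + 1)).embA U) ∧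
      (∀ (k : ℕ) (g : ℕ → ℝ) (U : ((w1 F θ).pairing k).BgA) (X : Node00.W1.Dom (F.P k) θ.τ9.M), k < X.1 → ((w1 F θ).pairing k).EA ((w1 F θ).S k) g U X = 0))
    (hA : ∀ (F : T4Family) (θ : Stage13Params F N), θ.Provisos₁₃Core F N → Rg F θ → θ.Admissible F N → ∀ (k : ℕ),
      ∀ g ∈ Window θ.γ, ∀ (U : (((w1 F θ).u3Objects θ.γ).levelCarriers k).BgA) (X : (((w1 F θ).u3Objects θ.γ).levelCarriers k).Dom) (i : ℕ),
        i < (((w1 F θ).u3Objects θ.γ).levelCarriers k).scale X → ∃ (Fz : ℂ → ℂ) (Dset : Set ℂ), DifferentiableOn ℂ Fz Dset ∧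
          (∀ z ∈ Dset, ‖Fz z‖ ≤ (w1 F θ).li.A * (w1 F θ).li.μ ^ ((((w1 F θ).u3Objects θ.γ).levelCarriers k).scale X - 1 - i) *
            Real.exp (-(((w1 F θ).u3Objects θ.γ).κ * (((w1 F θ).u3Objects θ.γ).levelCarriers k).d X))) ∧
          (∀ t ∈ Ioc (0 : ℝ) θ.γ, closedBall (t : ℂ) (w1 F θ).li.r ⊆ Dset) ∧
          (∀ t ∈ Ioc (0 : ℝ) θ.γ, Fz t = (((w1 F θ).u3Objects θ.γ).EA k (Function.update g i t) U X : ℂ)))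
    (hnum : ∀ (F : T4Family) (θ : Stage13Params F N), θ.Provisos₁₃Core F N → Rg F θ → θ.Admissible F N →
      0 < (w1 F θ).li.C₀ ∧ 0 < (w1 F θ).li.θ₅ ∧ (w1 F θ).li.θ₅ < 1 ∧ 0 ≤ (w1 F θ).li.C₅ ∧
        2 * (w1 F θ).li.C₅ / (1 - (w1 F θ).li.θ₅) ≤ (w1 F θ).li.C₀ ∧ 0 < (w1 F θ).li.A ∧ (w1 F θ).li.θ₅ ≤ (w1 F θ).li.μ ∧
        (w1 F θ).li.C₀ ≤ 2 * (w1 F θ).li.A ∧ 0 < (w1 F θ).li.r ∧ 0 < (w1 F θ).li.s ∧ (w1 F θ).li.s < 1) :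
    S_N22 (RRec₁₃CoOn (readingOfRecord₁₃Co w1 ℓ₃ ne2 ne1) Rg) :=
  s_N22_rRec₁₃CoOn_w1_of_s_N18_analytic _ w1 Rg (fun _ _ _ _ _ => rfl) h18 hcoh hA hnum

open Classical in
/-- **THE EDGE AT THE READING OF RECORD, REGIME HOME, STRIP CURRENCY** (§1 at `readingOfRecord₁₃Co w1 ℓ₃ ne2 ne1`, `hpin := rfl`). [folklore] -/
theorem s_N22_readingOfRecord₁₃CoOn_of_s_N18_stripBound (Rg : (F : T4Family) → Stage13Params F N → Prop)
    (h18 : S_N18 (RRec₁₃CoOn (readingOfRecord₁₃Co w1 ℓ₃ ne2 ne1) Rg))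
    (hcoh : ∀ (F : T4Family) (θ : Stage13Params F N), θ.Provisos₁₃Core F N → Rg F θ → θ.Admissible F N →
      (∀ (k : ℕ) (X₁ : Node00.W1.Dom (F.P k) θ.τ9.M), (((w1 F θ).pairing k).pair X₁).1 = X₁.1 + 1) ∧
      (∀ (k : ℕ) (X₁ : Node00.W1.Dom (F.P k) θ.τ9.M),
        (domSys (F.P (k + 1)) θ.τ9.M (((w1 F θ).pairing k).pair X₁).1).dj (((w1 F θ).pairing k).pair X₁).2 = (domSys (F.P k) θ.τ9.M X₁.1).dj X₁.2) ∧
      (∀ (k : ℕ) (X : Node00.W1.Dom (F.P (k + 1)) θ.τ9.M), 1 ≤ X.1 → ∃ X₁ : Node00.W1.Dom (F.P k) θ.τ9.M, ((w1 F θ).pairing k).pair X₁ = X) ∧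
      (∀ (k : ℕ) (U : ((w1 F θ).pairing (k + 1)).BgA), ∃ U₁ : ((w1 F θ).pairing k).BgB, ((w1 F θ).pairing k).embB U₁ = ((w1 F θ).pairing (k + 1)).embA U) ∧
      (∀ (k : ℕ) (g : ℕ → ℝ) (U : ((w1 F θ).pairing k).BgA) (X : Node00.W1.Dom (F.P k) θ.τ9.M), k < X.1 → ((w1 F θ).pairing k).EA ((w1 F θ).S k) g U X = 0))
    (hnum : ∀ (F : T4Family) (θ : Stage13Params F N), θ.Provisos₁₃Core F N → Rg F θ → θ.Admissible F N →
      0 < (w1 F θ).li.C₀ ∧ 0 < (w1 F θ).li.θ₅ ∧ (w1 F θ).li.θ₅ < 1 ∧ 0 ≤ (w1 F θ).li.C₅ ∧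
        2 * (w1 F θ).li.C₅ / (1 - (w1 F θ).li.θ₅) ≤ (w1 F θ).li.C₀ ∧ 0 < (w1 F θ).li.A ∧ (w1 F θ).li.θ₅ ≤ (w1 F θ).li.μ ∧
        (w1 F θ).li.C₀ ≤ 2 * (w1 F θ).li.A ∧ 0 < (w1 F θ).li.r ∧ 0 < (w1 F θ).li.s ∧ (w1 F θ).li.s < 1 ∧ 1 ≤ (w1 F θ).li.μ)
    (hstrip : ∀ (F : T4Family) (θ : Stage13Params F N), θ.Provisos₁₃Core F N → Rg F θ → θ.Admissible F N → ∀ (k : ℕ),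
      ∃ sp : (j : ℕ) → (domSys (F.P k) θ.τ9.M j).Dom → Set (CPair (F.P k) (MatA N)),
        (∀ (j : ℕ) (U : ((w1 F θ).pairing k).BgA) (Y : (domSys (F.P k) θ.τ9.M j).Dom), ((w1 F θ).pairing k).embA U ∈ sp j Y) ∧
        (∀ (j : ℕ) (g : ℕ → ℝ), g ∈ Window θ.γ → ∀ (i : ℕ) (Y : (domSys (F.P k) θ.τ9.M j).Dom) (ψ : CPair (F.P k) (MatA N)), ψ ∈ sp j Y →
          ∃ (Ec : ℂ → ℂ) (O : Set ℂ), IsOpen O ∧ (∀ t ∈ Ioc (0 : ℝ) θ.γ, closedBall (t : ℂ) (w1 F θ).li.r ⊆ O) ∧ DifferentiableOn ℂ Ec O ∧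
            (∀ z ∈ O, ‖Ec z‖ ≤ (w1 F θ).li.A * Real.exp (-((w1 F θ).li.κ * torusTreeLen Y.1))) ∧
            (∀ t ∈ Ioc (0 : ℝ) θ.γ, Ec t = termC ((w1 F θ).S k) j Y (Function.update g i t) ψ))) :
    S_N22 (RRec₁₃CoOn (readingOfRecord₁₃Co w1 ℓ₃ ne2 ne1) Rg) :=
  s_N22_rRec₁₃CoOn_w1_of_s_N18_stripBound _ w1 Rg (fun _ _ _ _ _ => rfl) h18 hcoh hnum hstrip

end ReadingOfRecord

end YMDAG.N22

end
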